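import Mathlib.RepresentationTheory.Basic
import Mathlib.LinearAlgebra.Matrix.ToLin
import Mathlib.Data.Matrix.Basic
import HarnessLib

/-!
# Matrix representations, their base change along ring homomorphisms, and equivariance of
# coordinatewise maps

Topic `RepresentationTheory/GeneralLinear`; namespace `Literature.RepresentationTheory.GeneralLinear`.
Definitions with bodies and theorems (Mathlib-only imports; no named fact, no instance, no `sorry`).

* `matrixRep A` — the representation `g ↦ (v ↦ A(g) v)` of a monoid `G` on `d → R` attached to a
  homomorphism `A : G →* Matrix d d R`; `toMatrixHom σ` — conversely the matrices of a
  representation on `d → R` (`matrixRep_toMatrixHom`);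
* `MonoidHom.mapMatrixHom A ψ` — the base change `g ↦ ψ(A(g))` along a ring homomorphism
  `ψ : S →+* R`;
* `Representation.ofLinearEquiv σ e` — transport of a representation along `e : N ≃ₗ (d → R)`,
  with `e (σ g v) = ofLinearEquiv σ e g (e v)`;
* **`pi_map_mulVec`** — for ring homomorphisms `ψ₁ : S → R₁`, `ψ₂ : S → R₂` and an additive
  `f : R₁ → R₂` with `f (ψ₁(s) x) = ψ₂(s) f(x)`, the coordinatewise map `f^d` intertwines the
  actions of `A^{ψ₁}` and `A^{ψ₂}`: `f^d (A^{ψ₁} w) = A^{ψ₂} (f^d w)`; whence the equivariance of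
  `f^d` for `matrixRep (A^{ψ₁})`, `matrixRep (A^{ψ₂})` (`pi_map_matrixRep`).  Instances: `f` a ring
  homomorphism over `S` (change of scalars of the values of a representation), `f` an `S`-linear
  retraction or a coordinate function of a free algebra (descent of classes / annihilators).

Use: transporting the finite-level coefficient systems `Fun(𝒢/L', (𝒪/p^t)^d)` of
[Scholze2015, §V.4] between the coefficient rings `𝒪_{E₀} ⊂ 𝒪_{E'} ⊂ ℤ̄_p`.

## References

* C. W. Curtis, I. Reiner, *Methods of Representation Theory* I (1981), §10A (matrix
  representations and extension of scalars). [folklore]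
* P. Scholze, Ann. of Math. 182 (2015), §V.4. [Scholze2015]
-/

namespace Literature.RepresentationTheory.GeneralLinear

open Matrix

variable {S R R₁ R₂ : Type*} [CommRing S] [CommRing R] [CommRing R₁] [CommRing R₂]
  {G : Type*} [Monoid G] {d : Type*} [Fintype d] [DecidableEq d]

/-! ### Matrix representations -/

/-- **The representation on `d → R` attached to `A : G →* Matrix d d R`**, `g ↦ (v ↦ A(g) v)`.
[folklore] -/
noncomputable def matrixRep (A : G →* Matrix d d R) : Representation R G (d → R) where
  toFun g := Matrix.toLin' (A g)
  map_one' := by rw [map_one, Matrix.toLin'_one]; rfl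
  map_mul' g h := by rw [map_mul, Matrix.toLin'_mul]; rfl

omit [Fintype d] [DecidableEq d] in
/-- `matrixRep A g v = A(g) *ᵥ v`. [folklore] -/
@[simp]
theorem matrixRep_apply [Fintype d] [DecidableEq d] (A : G →* Matrix d d R) (g : G) (v : d → R) :
    matrixRep A g v = (A g) *ᵥ v :=
  Matrix.toLin'_apply _ _

/-- **The matrices of a representation on `d → R`.** [folklore] -/
noncomputable def toMatrixHom (σ : Representation R G (d → R)) : G →* Matrix d d R where
  toFun g := LinearMap.toMatrix' (σ g)
  map_one' := by rw [map_one]; exact LinearMap.toMatrix'_id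
  map_mul' g h := by rw [map_mul]; exact LinearMap.toMatrix'_mul _ _

/-- Unfolding lemma. [folklore] -/
@[simp]
theorem toMatrixHom_apply (σ : Representation R G (d → R)) (g : G) :
    toMatrixHom σ g = LinearMap.toMatrix' (σ g) :=
  rfl

/-- `matrixRep (toMatrixHom σ) = σ`. [folklore] -/
theorem matrixRep_toMatrixHom (σ : Representation R G (d → R)) : matrixRep (toMatrixHom σ) = σ :=
  MonoidHom.ext fun g => by
    change Matrix.toLin' (LinearMap.toMatrix' (σ g)) = σ g
    rw [Matrix.toLin'_toMatrix']

/-- **Base change of a matrix representation along `ψ : S →+* R`**, `g ↦ ψ(A(g))`. [folklore] -/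
def _root_.MonoidHom.mapMatrixHom (A : G →* Matrix d d S) (ψ : S →+* R) : G →* Matrix d d R :=
  (RingHom.mapMatrix ψ).toMonoidHom.comp A

/-- Unfolding lemma. [folklore] -/
@[simp]
theorem _root_.MonoidHom.mapMatrixHom_apply (A : G →* Matrix d d S) (ψ : S →+* R) (g : G) :
    A.mapMatrixHom ψ g = (A g).map ψ :=
  rfl

/-- Base change is transitive: `(A^{ψ})^{ψ'} = A^{ψ' ∘ ψ}`. [folklore] -/
theorem _root_.MonoidHom.mapMatrixHom_mapMatrixHom (A : G →* Matrix d d S) (ψ : S →+* R₁)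
    (ψ' : R₁ →+* R₂) : (A.mapMatrixHom ψ).mapMatrixHom ψ' = A.mapMatrixHom (ψ'.comp ψ) :=
  MonoidHom.ext fun g => by simp [Matrix.map_map]

/-- Base change along the identity. [folklore] -/
theorem _root_.MonoidHom.mapMatrixHom_id (A : G →* Matrix d d S) :
    A.mapMatrixHom (RingHom.id S) = A :=
  MonoidHom.ext fun g => by simp

/-! ### Transport along a linear equivalence -/

/-- **Transport of a representation along `e : N ≃ₗ[R] N'`**: `g ↦ e ∘ σ(g) ∘ e⁻¹`. [folklore] -/
def _root_.Representation.ofLinearEquiv {N N' : Type*} [AddCommGroup N] [Module R N]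
    [AddCommGroup N'] [Module R N'] (σ : Representation R G N) (e : N ≃ₗ[R] N') :
    Representation R G N' where
  toFun g := e.toLinearMap ∘ₗ σ g ∘ₗ e.symm.toLinearMap
  map_one' := by
    rw [map_one]
    exact LinearMap.ext fun v => by simp
  map_mul' g h := by
    rw [map_mul]
    exact LinearMap.ext fun v => by simp

/-- Unfolding lemma. [folklore] -/
@[simp]
theorem _root_.Representation.ofLinearEquiv_apply {N N' : Type*} [AddCommGroup N] [Module R N]
    [AddCommGroup N'] [Module R N'] (σ : Representation R G N) (e : N ≃ₗ[R] N') (g : G) (w : N') :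
    σ.ofLinearEquiv e g w = e (σ g (e.symm w)) :=
  rfl

/-- **`e` is equivariant**: `e (σ g v) = (σ.ofLinearEquiv e) g (e v)`. [folklore] -/
theorem _root_.Representation.ofLinearEquiv_equivariant {N N' : Type*} [AddCommGroup N]
    [Module R N] [AddCommGroup N'] [Module R N'] (σ : Representation R G N) (e : N ≃ₗ[R] N')
    (g : G) (v : N) : e (σ g v) = σ.ofLinearEquiv e g (e v) := by
  rw [Representation.ofLinearEquiv_apply, LinearEquiv.symm_apply_apply]

/-! ### Equivariance of coordinatewise maps -/

omit [DecidableEq d] in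
/-- **`f^d (A^{ψ₁} w) = A^{ψ₂} (f^d w)`** for an additive `f : R₁ → R₂` with
`f (ψ₁(s) x) = ψ₂(s) f(x)`. [folklore] -/
theorem pi_map_mulVec (ψ₁ : S →+* R₁) (ψ₂ : S →+* R₂) (f : R₁ →+ R₂)
    (hf : ∀ (s : S) (x : R₁), f (ψ₁ s * x) = ψ₂ s * f x) (A : Matrix d d S) (w : d → R₁) :
    (fun i => f (((A.map ψ₁) *ᵥ w) i)) = (A.map ψ₂) *ᵥ fun i => f (w i) := by
  funext i
  simp only [Matrix.mulVec, dotProduct, Matrix.map_apply, map_sum, hf]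

/-- The same for the matrix representations: `f^d` intertwines `matrixRep (A^{ψ₁}) g` and
`matrixRep (A^{ψ₂}) g`. [folklore] -/
theorem pi_map_matrixRep (A : G →* Matrix d d S) (ψ₁ : S →+* R₁) (ψ₂ : S →+* R₂) (f : R₁ →+ R₂)
    (hf : ∀ (s : S) (x : R₁), f (ψ₁ s * x) = ψ₂ s * f x) (g : G) (w : d → R₁) :
    (fun i => f (matrixRep (A.mapMatrixHom ψ₁) g w i)) =
      matrixRep (A.mapMatrixHom ψ₂) g fun i => f (w i) := by
  rw [matrixRep_apply, matrixRep_apply, MonoidHom.mapMatrixHom_apply, MonoidHom.mapMatrixHom_apply]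
  exact pi_map_mulVec ψ₁ ψ₂ f hf (A g) w

/-- Special case `ψ₁ = id`: a ring homomorphism `ψ : S → R` intertwines `matrixRep A` and
`matrixRep (A^{ψ})` coordinatewise. [folklore] -/
theorem pi_map_matrixRep_self (A : G →* Matrix d d S) (ψ : S →+* R) (g : G) (w : d → S) :
    (fun i => ψ (matrixRep A g w i)) = matrixRep (A.mapMatrixHom ψ) g fun i => ψ (w i) := by
  have h := pi_map_matrixRep A (RingHom.id S) ψ (ψ : S →+ R) (fun s x => by simp) g w
  rwa [MonoidHom.mapMatrixHom_id] at h

/-- **The coordinatewise semilinear map `ψ^d : (d → S) →ₛₗ[ψ] (d → R)`.** [folklore] -/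
def piSemilinear (ψ : S →+* R) : (d → S) →ₛₗ[ψ] (d → R) where
  toFun w i := ψ (w i)
  map_add' w w' := funext fun i => by simp
  map_smul' s w := funext fun i => by simp

omit [Fintype d] [DecidableEq d] in
/-- Unfolding lemma. [folklore] -/
@[simp]
theorem piSemilinear_apply (ψ : S →+* R) (w : d → S) (i : d) : piSemilinear ψ w i = ψ (w i) :=
  rfl

/-- `ψ^d` is equivariant for `matrixRep A` and `matrixRep (A^{ψ})`. [folklore] -/
theorem piSemilinear_matrixRep (A : G →* Matrix d d S) (ψ : S →+* R) (g : G) (w : d → S) :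
    piSemilinear ψ (matrixRep A g w) = matrixRep (A.mapMatrixHom ψ) g (piSemilinear ψ w) :=
  pi_map_matrixRep_self A ψ g w

end Literature.RepresentationTheory.GeneralLinear
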